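import Literature.MathematicalPhysics.QuantumLattice.HubbardFreeTorusGroundEnergy
import Summits.HubbardSuperconductivity.HubbardSuperconductivity.Theorems.TwSeededEnsembleEquivalence.Negative.HalfFillingCounting

/-!
# Level counting on the free torus band (Template H′, part A) — crux `TwSeededEnsembleEquivalenceR` (stmt-HubbardSuperconductivity-15581)

Negative-side support lemmas (refuter, cdisprove gen 1), sorry-free and definition-free. Pure band/lattice facts for the
free dispersion `ε_L(k) = −2Σ_i cos(2πk_i/L)` on `(ℤ/Lℤ)²`, used by `PolynomialFloor.lean` (the `c₀/β³` thermal floor of the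
crux's defect functional) — the generalisation of `Negative/HalfFillingCounting.lean` (level `ν = 0`) to an ARBITRARY level
`ν ∈ [−4, 4]`: a `(J+1) × (J+1)` box of momenta on the zone diagonal next to the point `(θ, θ)`, `cos θ = −ν/4`, carries band
energies within `8π(J+1)/L` of `ν` (`cos` is 1-Lipschitz), hence

* `abs_torusBand_sub_level_le_of_box`, `sq_le_card_filter_abs_torusBand_sub_level_small`,
* `sq_le_card_filter_abs_torusBand_sub_le`: for `|ν| ≤ 4`, `0 < a ≤ 2`, `1 ≤ aL/(16π)`: `#{k : |ε_L(k) − ν| ≤ a} ≥ (aL/(16π))²`.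
-/

set_option linter.dupNamespace false

namespace Summit.HubbardSuperconductivity.HubbardSuperconductivity.Theorems.TwSeededEnsembleEquivalenceR.Negative

open Literature.MathematicalPhysics.QuantumLattice Literature.Probability.LatticeModels

noncomputable section

/-! ### A box of momenta at an arbitrary level of the band -/

section Band

variable {L : ℕ} [NeZero L]

/-- On the box `j₀ ≤ k_i ≤ j₀ + J` with `θ ≤ 2πj₀/L ≤ θ + 2π/L`, every angle is within `2π(J+1)/L` of `θ`, hence
`|ε_L(k) + 4cos θ| ≤ 8π(J+1)/L` (`cos` is 1-Lipschitz). [folklore] -/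
theorem abs_torusBand_sub_level_le_of_box (θ : ℝ) (j₀ J : ℕ)
    (hlo : θ ≤ 2 * Real.pi * j₀ / L) (hhi : 2 * Real.pi * j₀ / L ≤ θ + 2 * Real.pi / L)
    (k : TorusSite 2 L) (hk : ∀ i : Fin 2, j₀ ≤ (k i).val ∧ (k i).val ≤ j₀ + J) :
    |torusBand L k + 4 * Real.cos θ| ≤ 8 * Real.pi * (J + 1) / L := by
  have hL0 : 0 < L := Nat.pos_of_ne_zero (NeZero.ne L)
  have hLr : (0 : ℝ) < L := by exact_mod_cast hL0
  have hπ := Real.pi_pos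
  set T : ℝ := 2 * Real.pi * (J + 1) / L with hT
  have hT0 : 0 ≤ T := by positivity
  have hang : ∀ x : ℕ, j₀ ≤ x → x ≤ j₀ + J → |2 * Real.pi * (x : ℝ) / L - θ| ≤ T := by
    intro x hx1 hx2
    have hx1r : (j₀ : ℝ) ≤ x := by exact_mod_cast hx1
    have hx2r : (x : ℝ) ≤ j₀ + J := by exact_mod_cast hx2
    rw [abs_le]
    constructor
    · have h1 : 2 * Real.pi * (j₀ : ℝ) / L ≤ 2 * Real.pi * (x : ℝ) / L :=
        div_le_div_of_nonneg_right (by nlinarith) hLr.le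
      linarith
    · have h1 : 2 * Real.pi * (x : ℝ) / L ≤ 2 * Real.pi * (j₀ : ℝ) / L + 2 * Real.pi * (J : ℝ) / L := by
        rw [← add_div, div_le_div_iff_of_pos_right hLr]
        nlinarith
      have h2 : T = 2 * Real.pi / L + 2 * Real.pi * (J : ℝ) / L := by
        rw [hT, ← add_div]; ring
      linarith
  have hcos : ∀ x : ℕ, j₀ ≤ x → x ≤ j₀ + J →
      |Real.cos (2 * Real.pi * (x : ℝ) / L) - Real.cos θ| ≤ T :=
    fun x hx1 hx2 => (Real.abs_cos_sub_cos_le _ _).trans (hang x hx1 hx2)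
  have hc0 := hcos (k 0).val (hk 0).1 (hk 0).2
  have hc1 := hcos (k 1).val (hk 1).1 (hk 1).2
  have hband : torusBand L k =
      -2 * (Real.cos (2 * Real.pi * ((k 0).val : ℝ) / L) + Real.cos (2 * Real.pi * ((k 1).val : ℝ) / L)) := by
    simp only [torusBand, Fin.sum_univ_two, latticeMomentum_apply]
  rw [hband]
  have e : -2 * (Real.cos (2 * Real.pi * ((k 0).val : ℝ) / L) + Real.cos (2 * Real.pi * ((k 1).val : ℝ) / L)) +
      4 * Real.cos θ =
      (-2) * ((Real.cos (2 * Real.pi * ((k 0).val : ℝ) / L) - Real.cos θ) +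
        (Real.cos (2 * Real.pi * ((k 1).val : ℝ) / L) - Real.cos θ)) := by ring
  rw [e, abs_mul]
  have h3 := abs_add_le (Real.cos (2 * Real.pi * ((k 0).val : ℝ) / L) - Real.cos θ)
    (Real.cos (2 * Real.pi * ((k 1).val : ℝ) / L) - Real.cos θ)
  have h2 : |(-2 : ℝ)| = 2 := by norm_num
  rw [h2]
  calc 2 * |(Real.cos (2 * Real.pi * ((k 0).val : ℝ) / L) - Real.cos θ) +
        (Real.cos (2 * Real.pi * ((k 1).val : ℝ) / L) - Real.cos θ)| ≤ 2 * (T + T) := by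
        nlinarith [h3, hc0, hc1]
    _ = 8 * Real.pi * (J + 1) / L := by rw [hT]; ring

/-- **Level box count**: for `0 ≤ θ ≤ π` and `2(J+1) + 4 ≤ L`, at least `(J+1)²` momenta have
`|ε_L(k) + 4cos θ| ≤ 8π(J+1)/L` (the box `(j₀ + p, j₀ + q)`, `p, q ≤ J`, `j₀ = ⌈θL/(2π)⌉`). [folklore] -/
theorem sq_le_card_filter_abs_torusBand_sub_level_small (θ : ℝ) (hθ0 : 0 ≤ θ) (hθπ : θ ≤ Real.pi) (J : ℕ)
    (hJ : 2 * (J + 1) + 4 ≤ L) :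
    (J + 1) ^ 2 ≤ (Finset.univ.filter fun k : TorusSite 2 L =>
      |torusBand L k + 4 * Real.cos θ| ≤ 8 * Real.pi * (J + 1) / L).card := by
  classical
  have hL0 : 0 < L := Nat.pos_of_ne_zero (NeZero.ne L)
  have hLr : (0 : ℝ) < L := by exact_mod_cast hL0
  have hπ := Real.pi_pos
  set j₀ : ℕ := ⌈θ * L / (2 * Real.pi)⌉₊ with hj₀
  have hx0 : 0 ≤ θ * L / (2 * Real.pi) := by positivity
  have hj₀lt : (j₀ : ℝ) < θ * L / (2 * Real.pi) + 1 := Nat.ceil_lt_add_one hx0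
  have hj₀ge : θ * L / (2 * Real.pi) ≤ j₀ := Nat.le_ceil _
  have hhalf : θ * L / (2 * Real.pi) ≤ L / 2 := by
    rw [div_le_div_iff₀ (by positivity) (by norm_num)]
    nlinarith
  have hjJ : j₀ + J < L := by
    have h2 : (2 * (J + 1) + 4 : ℝ) ≤ L := by exact_mod_cast hJ
    have : (j₀ : ℝ) + J < L := by linarith
    exact_mod_cast this
  have hlo : θ ≤ 2 * Real.pi * j₀ / L := by
    rw [le_div_iff₀ hLr]
    rw [div_le_iff₀ (by positivity)] at hj₀ge
    linarith
  have hhi : 2 * Real.pi * j₀ / L ≤ θ + 2 * Real.pi / L := by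
    have e : θ + 2 * Real.pi / L = (θ * L + 2 * Real.pi) / L := by field_simp
    rw [e, div_le_div_iff_of_pos_right hLr]
    have h5 : ((j₀ : ℝ) - 1) * (2 * Real.pi) < θ * L := by
      have := sub_lt_iff_lt_add.2 hj₀lt
      rwa [lt_div_iff₀ (by positivity)] at this
    nlinarith
  set F : ℕ × ℕ → TorusSite 2 L := fun p i => if i = 0 then ((j₀ + p.1 : ℕ) : ZMod L) else ((j₀ + p.2 : ℕ) : ZMod L)
    with hF
  have hF0 : ∀ p : ℕ × ℕ, j₀ + p.1 < L → (F p 0).val = j₀ + p.1 := fun p hp => by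
    show ((j₀ + p.1 : ℕ) : ZMod L).val = j₀ + p.1
    rw [ZMod.val_natCast, Nat.mod_eq_of_lt hp]
  have hF1 : ∀ p : ℕ × ℕ, j₀ + p.2 < L → (F p 1).val = j₀ + p.2 := fun p hp => by
    show (if (1 : Fin 2) = 0 then ((j₀ + p.1 : ℕ) : ZMod L) else ((j₀ + p.2 : ℕ) : ZMod L)).val = j₀ + p.2
    rw [if_neg (by decide), ZMod.val_natCast, Nat.mod_eq_of_lt hp]
  set S := (Finset.range (J + 1)) ×ˢ (Finset.range (J + 1)) with hS
  have hinj : Set.InjOn F S := by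
    intro p hp p' hp' heq
    simp only [hS, Finset.coe_product, Finset.coe_range, Set.mem_prod, Set.mem_Iio] at hp hp'
    have e0 := congrArg ZMod.val (congrFun heq 0)
    have e1 := congrArg ZMod.val (congrFun heq 1)
    rw [hF0 p (by omega), hF0 p' (by omega)] at e0
    rw [hF1 p (by omega), hF1 p' (by omega)] at e1
    exact Prod.ext (by omega) (by omega)
  have hcard : (S.image F).card = (J + 1) ^ 2 := by
    rw [Finset.card_image_of_injOn hinj, hS, Finset.card_product, Finset.card_range, sq]
  rw [← hcard]
  refine Finset.card_le_card fun k hk => ?_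
  rw [Finset.mem_image] at hk
  obtain ⟨p, hp, rfl⟩ := hk
  simp only [hS, Finset.mem_product, Finset.mem_range] at hp
  rw [Finset.mem_filter]
  refine ⟨Finset.mem_univ _, abs_torusBand_sub_level_le_of_box θ j₀ J hlo hhi (F p) fun i => ?_⟩
  fin_cases i
  · show j₀ ≤ (F p 0).val ∧ (F p 0).val ≤ j₀ + J
    rw [hF0 p (by omega)]; omega
  · show j₀ ≤ (F p 1).val ∧ (F p 1).val ≤ j₀ + J
    rw [hF1 p (by omega)]; omega

/-- **Extensive count at every level of the band**: for `|ν| ≤ 4`, `0 < a ≤ 2` and `1 ≤ aL/(16π)`: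
`#{k : |ε_L(k) − ν| ≤ a} ≥ (aL/(16π))²`. [folklore] -/
theorem sq_le_card_filter_abs_torusBand_sub_le {ν a : ℝ} (hν : |ν| ≤ 4) (ha : 0 < a) (ha2 : a ≤ 2)
    (hL : 1 ≤ a * L / (16 * Real.pi)) :
    (a * L / (16 * Real.pi)) ^ 2 ≤
      ((Finset.univ.filter fun k : TorusSite 2 L => |torusBand L k - ν| ≤ a).card : ℝ) := by
  have hL0 : 0 < L := Nat.pos_of_ne_zero (NeZero.ne L)
  have hLr : (0 : ℝ) < L := by exact_mod_cast hL0
  have hπ := Real.pi_pos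
  have hπ3 := Real.pi_gt_three
  -- the level angle
  rw [abs_le] at hν
  set θ : ℝ := Real.arccos (-ν / 4) with hθ
  have hcosθ : Real.cos θ = -ν / 4 := by
    rw [hθ, Real.cos_arccos (by linarith) (by linarith)]
  have hθ0 : 0 ≤ θ := Real.arccos_nonneg _
  have hθπ : θ ≤ Real.pi := Real.arccos_le_pi _
  -- the box size
  set n : ℕ := ⌊a * L / (8 * Real.pi)⌋₊ with hn
  have hx0 : 0 ≤ a * L / (8 * Real.pi) := by positivity
  have hnle : (n : ℝ) ≤ a * L / (8 * Real.pi) := Nat.floor_le hx0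
  have hnge : a * L / (8 * Real.pi) - 1 ≤ n := by
    have := Nat.lt_floor_add_one (a * L / (8 * Real.pi)); rw [← hn] at this; linarith
  have h2 : a * L / (8 * Real.pi) = 2 * (a * L / (16 * Real.pi)) := by
    rw [mul_div_assoc' 2, div_eq_div_iff (by positivity) (by positivity)]; ring
  have hn1 : (1 : ℝ) ≤ n := by linarith
  have hn1' : 1 ≤ n := by exact_mod_cast hn1
  -- 2 n + 4 ≤ L
  have hL24 : (24 : ℝ) < L := by
    rw [le_div_iff₀ (by positivity)] at hL
    have : a * L ≤ 2 * L := by nlinarith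
    nlinarith
  have h2n : 2 * (n - 1 + 1) + 4 ≤ L := by
    rw [Nat.sub_add_cancel hn1']
    have : 2 * (n : ℝ) + 4 ≤ L := by
      have e8 : 8 * (a * L / (8 * Real.pi)) = a * L / Real.pi := by
        rw [mul_div_assoc' 8, div_eq_div_iff (by positivity) (by positivity)]; ring
      have h3 : a * L / Real.pi ≤ 2 * L / 3 := by
        rw [div_le_div_iff₀ hπ (by norm_num)]; nlinarith
      linarith
    exact_mod_cast this
  have hbox := sq_le_card_filter_abs_torusBand_sub_level_small (L := L) θ hθ0 hθπ (n - 1) h2n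
  rw [Nat.sub_add_cancel hn1'] at hbox
  -- the box levels satisfy |ε − ν| ≤ 8π n/L ≤ a
  have hthr : 8 * Real.pi * ((n - 1 : ℕ) + 1 : ℝ) / L ≤ a := by
    have : ((n - 1 : ℕ) : ℝ) + 1 = n := by
      rw [Nat.cast_sub hn1']; push_cast; ring
    rw [this, div_le_iff₀ hLr]
    have := mul_le_mul_of_nonneg_left hnle (by positivity : (0 : ℝ) ≤ 8 * Real.pi)
    have h4 : 8 * Real.pi * (a * L / (8 * Real.pi)) = a * L := by field_simp
    linarith
  have hsub : (Finset.univ.filter fun k : TorusSite 2 L =>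
      |torusBand L k + 4 * Real.cos θ| ≤ 8 * Real.pi * ((n - 1 : ℕ) + 1) / L) ⊆
      (Finset.univ.filter fun k : TorusSite 2 L => |torusBand L k - ν| ≤ a) := by
    intro k hk
    rw [Finset.mem_filter] at hk ⊢
    refine ⟨hk.1, ?_⟩
    have e : torusBand L k - ν = torusBand L k + 4 * Real.cos θ := by rw [hcosθ]; ring
    rw [e]
    exact hk.2.trans hthr
  have hcardle := Finset.card_le_card hsub
  have : ((n : ℝ)) ^ 2 ≤ ((Finset.univ.filter fun k : TorusSite 2 L => |torusBand L k - ν| ≤ a).card : ℝ) := by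
    have := hbox.trans hcardle
    exact_mod_cast this
  have hn2 : a * L / (16 * Real.pi) ≤ n := by linarith
  calc (a * L / (16 * Real.pi)) ^ 2 ≤ (n : ℝ) ^ 2 := pow_le_pow_left₀ (by positivity) hn2 2
    _ ≤ _ := this

end Band

end

end Summit.HubbardSuperconductivity.HubbardSuperconductivity.Theorems.TwSeededEnsembleEquivalenceR.Negative
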